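import Literature.MathematicalPhysics.QuantumFieldTheory.Balaban1983to89.Node00.Record13SepCoPHChi
import Summits.QuantumFields.YangMills.Theorems.BalabanUVNodesRateCarriersOfRecord13CoPHCmap
import Summits.QuantumFields.YangMills.Theorems.BalabanUVNodesSpineCarriersOfRecord13CoPHCmap
import Summits.QuantumFields.YangMills.Theorems.BalabanUVNodesSpineReadingOfRecord13CoPHChi
import Summits.QuantumFields.YangMills.Theorems.BalabanUVNodesN21GappedTopPairReading13CoPHDefsCmap
import Summits.QuantumFields.YangMills.Theorems.BalabanUVNodesN21ShellSplitOfRecord13CoPHDefsCmap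
import Summits.QuantumFields.YangMills.Theorems.BalabanUVNodesN21ShellSplitSelected13CoPHDefsCmap
import Summits.QuantumFields.YangMills.Theorems.BalabanUVNodesN14SourceTowerOfRecordAx
import Summits.QuantumFields.YangMills.Theorems.BalabanUVNodesN14DressedTowerGuardAx
import Summits.QuantumFields.YangMills.Theorems.BalabanUVNodesN15PairedFamilyGuardAx
import Summits.QuantumFields.YangMills.Theorems.BalabanUVNodesN16PinnedLayer13CoPHAx
import Summits.QuantumFields.YangMills.Theorems.BalabanUVNodesN22AtU3OfKernelsAx
import Summits.QuantumFields.YangMills.Theorems.BalabanUVNodesN18U3GuardsAtRateReadingCmap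
import Summits.QuantumFields.YangMills.Theorems.BalabanUVNodesN27ReadOutAtU3OfKernelsAx
import Summits.QuantumFields.YangMills.Theorems.BalabanUVNodesRateCarriersOfRecord13CoPH
import Literature.MathematicalPhysics.QuantumFieldTheory.Balaban1983to89.Node00.U3OfKernelsChi
import Summits.QuantumFields.YangMills.Theorems.BalabanUVNodesSpineReadingOfRecord13CoPHV
import Summits.QuantumFields.YangMills.Theorems.BalabanUVNodesN22AtU3OfKernels
import Summits.QuantumFields.YangMills.Theorems.BalabanUVNodesN18U3GuardsAtKernels
import Summits.QuantumFields.YangMills.Theorems.BalabanUVNodesN27ReadOutAtU3OfKernels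
import Summits.QuantumFields.YangMills.Theorems.BalabanUVNodesN14DressedTowerGuard
import Summits.QuantumFields.YangMills.Theorems.BalabanUVNodesN15PairedFamilyGuard
import Summits.QuantumFields.YangMills.Theorems.BalabanUVNodesN15FullPropagatorSizedRecord
import Summits.QuantumFields.YangMills.Theorems.BalabanUVNodesN18U3TowerGuards
import Summits.QuantumFields.YangMills.Theorems.BalabanUVNodesN19CoreEdgeFSCComposer
import Summits.QuantumFields.YangMills.Theorems.BalabanUVNodesN14SourceTowerOfRecord
import Summits.QuantumFields.YangMills.Theorems.BalabanUVNodesN18BetaOfRecordBoxDegeneracy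
import Summits.QuantumFields.YangMills.Theorems.BalabanUVNodesN15FullPropagatorSizedNonVanishing
import Summits.QuantumFields.YangMills.Theorems.BalabanUVNodesN16PinnedLayer13CoPH
import Summits.QuantumFields.YangMills.Theorems.BalabanUVNodesN21GappedTopPairReading13CoPHDefs
import Literature.MathematicalPhysics.QuantumFieldTheory.Balaban1983to89.Node00.Record13SepCoPHV

/-!
# K3ᴬ v8 — THE TREE MIRROR OF THE REGISTERED SKELETON's §1 ∕ §1b ∕ §1V ∕ §1c TEXTS (`K3Skeleton13SepCoPHAxV8.lean` b38fad1764a2d455, plan g100, registered on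
# stmt-QuantumFields-27247 `SpineGivenEndpointR13SepCoPHVAx` 2026-08-31T04:29:02Z), so that the lanes' v8 stub shares can be filed BY NAME — the Ax-tower analogue of
# dag-n27-w1's `K3V5Defs` (p606160) ∕ `K3V6Defs` ∕ dag-n21-d's `K3V7Defs` (the CoPH-tower mirrors of K3⁸)

R134 seat `pub-ymgap-dag-n16-e` (g31; op-5c K3ᴬ supply hand; dag-lead WORDS 645 (3) GO, cross-lane, explicit), `--kind definition --supports stmt-QuantumFields-27247 --as helper`
(count-neutral; nothing registered — the plan keeps the registered skeleton; on any v9 re-cut this mirror is superseded).  THIS FILE = the registered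
skeleton's lines :261–:575 VERBATIM (namespace `…Theses.BalabanUVNodes.K3Skeleton13SepCoPHAxV8` ↦ `…Theorems.K3AxV8Defs`; its imports minus the route file; every `def` ∕
`abbrev` ∕ `theorem` and every docstring byte-identical; the kit's first import `…N27SpineGivenEndpointR13SepCoPHKeyedCore` — which builds on the route
file — is replaced by `Node00.Record13SepCoPHChi` (the home of `Provisos₁₃SepCoPHAx` ∕ `Revision₁₃Ax` ∕ `datumOfRecord₁₃SepCoPHVAx`), so this file is OUTSIDE the Theses cone): the reading types `SpineReading` ∕ `RateReading13AxP` ∕ `RateReadingFn` ∕ `RunSel` ∕ `LetterReading` ∕ `CutReading`,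
`rrOfRecord`, `PHolderD4`, `KeyedRatesHolderD4`; §1b `KeyedSensitive`, `N15PinnedSized`, `U3PinnedKernels`, `ne1PinnedOfRecord_iff`, `GuardedReading`, `N16RadiusMatch`,
`GuardedReadingN16`, `guardedReading_of_n16`, `UnityNondegAx`, `ne1NondegenerateOn_of_guardedReading`, `n14At_rrOfRecord_of_pinned`, `KeyedRelWeight`, `KeyedShellWeight`,
`KeyedCoreEdgeHolderD4`, `KeyedExtraction`; §1V `KeyedRatesHolderD4V ∕ BFree` (+ transfer lemmas), `KeyedCoreEdgeHolderD4V ∕ BFree`, `KeyedExtractionV ∕ BFree`; §1c `LiveSel`,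
`PinnedAtLive`, `PinnedAtLiveGap2`, `DialRows`.  The stub TEXTS, the §2 pin lemmas and the by-name composition onto the route decl are the companion
`Thm/BalabanUVNodesK3AxV8StubTexts` (which imports the route file; this file does NOT — Theses-free, importable by every lane).  If the registered texts ever differ from these,
this file is superseded, not edited.

HONEST FRAMING.  Definitions mirrored from the registered kit + their own kernel bookkeeping; no estimate; nothing of Bałaban asserted or instantiated; no stub of K3ᴬ v8 proved
or claimed; K3ᴬ OPEN (v8 0∕2); counts UNMOVED (typed 28∕28 · discharged 8∕27, A 8∕28).  One finite 𝕋⁴ programme at fixed `ε` — NOT continuum ∕ ℝ⁴ ∕ OS ∕ mass gap ∕ Clay.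
No `sorry`, `instance`, `notation`; standard axioms.  The skeleton's own header (history v4–v8) is not repeated here; its docstrings below are VERBATIM.
-/

set_option autoImplicit false

noncomputable section

namespace Summit.QuantumFields.YangMills.Theorems.K3AxV8Defs

open Literature.MathematicalPhysics.QuantumFieldTheory.Balaban1983to89
open Literature.MathematicalPhysics.QuantumFieldTheory.Balaban1983to89.T4Continuum
open T4WeightBudget (RelWeightBound)
open T4IndicatorShell (ShellWeightBound)
open T4ContinuumYM4Torus (ForSmallCouplings)
open Summit.QuantumFields.BalabanUV.T4Continuum.Spine
open YMDAG.UVSplit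
open Node00 (Stage13HParams datumOfRecord₁₃CoPHAx U3Letters₁₁ betaOfRecord₁₃Ax)
open Literature.MathematicalPhysics.QuantumFieldTheory.Balaban1983to89.Node00.U3OfKernels (objectsOfRecord₁₃Ax KernelDecayOfRecord₁₃Ax)
open Literature.MathematicalPhysics.QuantumFieldTheory.Balaban1983to89.T4OutputRate (Window NE9)
open Literature.MathematicalPhysics.QuantumFieldTheory.Balaban1983to89.B12Sec2to5 (betaPrime510)
open YMDAG.N22.AtKernels (n22At_rateCarriersAx_of_kernels_pin_of_ne9)
open YMDAG.N18.U3GuardsAtKernels (sensitiveOnBoxes_rateCarriersAx_of_kernels_pin boxwiseConstant_betaOfRecord₁₃Ax_of_blind_kernels_pin sensitiveOnBoxes_rateCarriersAx_of_kernels_pin_of_remainderNonvanishing betaOfRecord₁₃Ax_eq_anchor_of_blind_kernels_pin)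
open Summit.QuantumFields.YangMills.BalabanUVNodes.N27ReadOutAtU3OfKernels (readOutAt_objectsOfRecord₁₃Ax_coPH)
open Summit.QuantumFields.YangMills.BalabanUVNodes.SpineRatesHolder (RatesHolderAt)
open YMDAG.N14.TowerGuard (Ne1NondegenerateOnAx Ne1NondegenerateOnCmap not_ne1NondegenerateOnCmap_of_isEmpty)
open Summit.QuantumFields.YangMills.BalabanUVNodes.N15.PairedFamilyGuard (KeyedLiveAx KeyedLiveCmap not_keyedLiveCmap_of_isEmpty keyedLiveCmap_of_no_tuple)
open YMDAG.N18.U3Guards (SensitiveOnBoxes BlindOnBoxes BoxwiseConstant not_sensitiveOnBoxes_of_blind blindOnBoxes_of_forall_eq_zero blindOnBoxes_of_couplingBlind)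
open Summit.QuantumFields.YangMills.BalabanUVNodes.N15.GenuineRecord (fullGSizedObjects n15At_fullGSizedObjects_family)
open Summit.QuantumFields.YangMills.BalabanUVNodes.N15.AtKeyedHome (neZero_blockFactor)
open Summit.QuantumFields.YangMills.BalabanUVNodes.N19CoreEdgeFSCComposer (keyedGuarded₁₃CoPH_of_keyedFacesP_fsc)
open YMDAG.N14.TopBorn (Ne1PinnedOfRecordAx Ne1PinnedOfRecordCmap ne1OfRecordAx ne1OfRecordChi ne1NondegenerateOnCmap_of_ne1PinnedOfRecord n14At_rateCarriersCmap_of_pinned)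
open YMDAG.N18.BetaBoxDegeneracy (RemainderNonvanishingOnBoxes)
open Summit.QuantumFields.YangMills.BalabanUVNodes.N15.SizedNonVanishing (ne_fullGSizedObjects_of_kop_zero_family)
open Summit.QuantumFields.YangMills.BalabanUVNodes.N16PinnedLayer13CoPH (N16PinnedLooseAx N16LettersEnd)
open Summit.QuantumFields.YangMills.Theorems.N21ShellSplitOfRecord13CoPH (WidthLetter₁₃CoPHAx DepthLetter₁₃CoPHAx)  -- v8e (v7: parents)
open Summit.QuantumFields.YangMills.Theorems.N21GappedTopPair13CoPH (crGap2₁₃VAx)  -- v8e (v7: parent)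

/-! ## §1 Readings keyed on the Stage-13 CORE provisos (leaf D's key) -/

/-- a READING of spine carriers off the Stage-13 tuples with core provisos (leaf D's `cr`) — dag-n20-d's `SpineReading₁₃CoPH 2` BY NAME, the type of
`crOfRecord₁₃V jcut sh` (v3: physical-volume edition). -/
abbrev SpineReading : Type 1 :=
  SpineReading₁₃CoPHAx 2  -- v8e σ6: T2-core's `SpineReading₁₃CoPHAx` BY NAME (p805745) = v8d's displayed Π-type by `rfl`

/-- v8e: THE Ax RATE READING OF THE TREE (`RateReading₁₃CoPHAx 2 = RateReading₁₃CoPHCmap 2 (fun F => Node00.chiβOfRecord₁₃Ax F 2)`, T1-core p805119) — v8d's probe-local stand-in retired. -/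
abbrev RateReading13AxP : Type _ :=
  RateReading₁₃CoPHAx 2  -- v8e σ6: T1-core's `RateReading₁₃CoPHAx` BY NAME (p805119; fields `lit`∕`ne1` keyed on `θ.Provisos₁₃CoPHAx F 2`)

/-- a READING of rate carriers off the Stage-13 tuples with core provisos (leaf D's `rr`). -/
abbrev RateReadingFn : Type _ :=
  (F : T4Family) → (θ : Stage13HParams F 2) → θ.Provisos₁₃CoPHAx F 2 → (ℕ → ℝ) → List (ULoop F) → RateCarriers 2

/-- a RUN-LENGTH SELECTOR: which run length `k` of the bundle of record is read at `(F, θ, hP, g₀, os)`. -/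
abbrev RunSel : Type _ :=
  (F : T4Family) → (θ : Stage13HParams F 2) → θ.Provisos₁₃CoPHAx F 2 → (ℕ → ℝ) → List (ULoop F) → ℕ

/-- a LETTER-BLOCK READING (v3, (t-U3)): node U3's K-uniform letters `κ, θ₅, C₅, moduli, C₉, ω, cr, ρ` read at `(F, θ)` — the `ℓ F θ` of the three producer files. -/
abbrev LetterReading : Type _ :=
  (F : T4Family) → Stage13HParams F 2 → U3Letters₁₁

/-- a CUT-POLICY READING (v3, (t-JC)): the large-field cut depth `K ↦ j(K)` read PER TUPLE, like the shell split. -/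
abbrev CutReading : Type _ :=
  (F : T4Family) → (θ : Stage13HParams F 2) → θ.Provisos₁₃CoPHAx F 2 → (ℕ → ℝ) → List (ULoop F) → ℕ → ℕ

/-- **THE RATE READING OF RECORD** read from the Stage-13 rate reading `𝔯` at the selected run length: `rateCarriersOfRecord₁₃CoPH 𝔯 F θ hP g₀ os (ksel F θ hP g₀ os)` —
node U3's window ∕ γ ∕ fading-memory letters ARE θ's; `𝔯.lit`, `𝔯.ne1` residual (R2, pins pending). -/
def rrOfRecord (𝔯 : RateReading13AxP) (ksel : RunSel) : RateReadingFn :=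
  fun F θ hP g₀ os => rateCarriersOfRecord₁₃CoPHCmap 𝔯 F θ hP g₀ os (ksel F θ hP g₀ os)

/-- **THE v2 RATES PREDICATE** `P := R-β rates ∧ (D4) read-out ∧ node U3's rate letter displayed`: dag-n16-e's `RatesHolderAt D R β`, the β-read-out binders
`ReadOutAt D R.u3` on the datum, AND (A3-ii) the K2⁷-junction letter `0 ≤ R.u3.ρ < 1` (node U3's θ-shift rate in `[0, 1[`, residual in `𝔯.lit`). -/
def PHolderD4 (β : ℝ) {F : T4Family} (D : Datum F 2) (R : RateCarriers 2) : Prop :=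
  RatesHolderAt D R β ∧ ReadOutAt D R.u3 ∧ (0 ≤ R.u3.ρ ∧ R.u3.ρ < 1)

/-- K4 (v4, (t9)∕№204) · the R-β rates with (D4) AT THE READING OF RECORD on the datum of record, at every guarded admissible Stage-13 tuple UNDER THE CRUX's OWN PREFIX:
statement (B) at the tuple → the UV endpoint → `ForSmallCouplings D` (every bare sequence `g₀` TUNED to a small renormalised coupling within a small window, [Balaban1987RG1]
Thm 2 p. 259), every `os` — the `hrates` shape of dag-n19-w3's `keyedGuarded₁₃CoPH_of_keyedFacesP_fsc` VERBATIM at `P := PHolderD4 β` (v1–v3 asked it at EVERY `g₀`). -/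
def KeyedRatesHolderD4 (β : ℝ) (rr : RateReadingFn) : Prop :=
  ∀ (F : T4Family) (θ : Stage13HParams F 2) (hP : θ.Provisos₁₃CoPHAx F 2), (θ.ZhUnity F 2 ∧ θ.SlotsNondegenerate₁₃Ax F 2) → θ.Admissible F 2 →
    B16.EndStatementBPrinted (datumOfRecord₁₃CoPHAx F 2 θ hP).C → DagBinding.EndpointExistence (datumOfRecord₁₃CoPHAx F 2 θ hP).C.toB12 →
      ForSmallCouplings (datumOfRecord₁₃CoPHAx F 2 θ hP) fun g₀ => ∀ os : List (ULoop F), PHolderD4 β (datumOfRecord₁₃CoPHAx F 2 θ hP) (rr F θ hP g₀ os)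

/-! ## §1b THE NONDEGENERACY GUARDS CONJOINED WHERE `∃ 𝔯` STANDS (R2 fallback road; the three landed guard files BY NAME) -/

/-- N18 ∕ node U3 keyed SENSITIVITY PREDICATE — **v4: DISPLAYED ONLY, NO LONGER A CONJUNCT OF `GuardedReading`** (№ 13, dag-n18-w2 p596517: under the node-U3 pin its content at a
tuple is «β₁₃ of record not boxwise constant» = anchor + the MISSING LETTER `RemainderNonvanishingOnBoxes`, an unprinted lower bound nobody owes; roads §2b (ii)∕(ii′), failure
mode §4 (iv)): at every guarded admissible Stage-13 tuple the SELECTED level functional `u3.EA` of the bundle of record is COUPLING-SENSITIVE over the record's boxes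
(dag-n18-w2's `SensitiveOnBoxes`; by `sensitiveOnBoxes_u3OfRecord₁₃_iff` it reads `SensitiveOnBoxes ((𝔯.lit …).u3.EA (ksel …)) θ.γ`). -/
def KeyedSensitive (𝔯 : RateReading13AxP) (ksel : RunSel) : Prop :=
  ∀ (F : T4Family) (θ : Stage13HParams F 2) (hP : θ.Provisos₁₃CoPHAx F 2), (θ.ZhUnity F 2 ∧ θ.SlotsNondegenerate₁₃Ax F 2) → θ.Admissible F 2 →
    ∀ (g₀ : ℕ → ℝ) (os : List (ULoop F)),
      SensitiveOnBoxes (rrOfRecord 𝔯 ksel F θ hP g₀ os).u3.EA (rrOfRecord 𝔯 ksel F θ hP g₀ os).u3.γ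

/-- **(A3-iii) THE (α-N15) PIN, MODEL LEVEL**: the reading's N15 objects at EVERY Stage-13 tuple with core provisos and EVERY run length ARE dag-n15-a's SIZED GENUINE
objects `fullGSizedObjects 3 F.hL b a_S ν μ α β c₃₅ p` on the family's own block factor, for SOME `b, a_S > 0`, directions `ν μ α β : Fin 4`, letters `c₃₅, p` — Bałaban's
[B6] (3.42) ∕ [B9] genuine `U ≡ 1` propagator kernels: MODEL LEVEL with respect to the datum's background field (said honestly; the background-dressed [B9] operator layer of
the run re-pins this slot in a later edition).  Under the pin the N15 conjunct holds OUTRIGHT (`n15At_rrOfRecord_of_pinned`, §2). -/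
def N15PinnedSized (𝔯 : RateReading13AxP) : Prop :=
  ∃ (b aS : ℝ) (ν μ α β : Fin 4) (c35 p : ℝ), 0 < b ∧ 0 < aS ∧
    ∀ (F : T4Family) (θ : Stage13HParams F 2) (hP : θ.Provisos₁₃CoPHAx F 2) (g₀ : ℕ → ℝ) (os : List (ULoop F)) (k : ℕ),
      (𝔯.lit F θ hP g₀ os).ne2 k = haveI := neZero_blockFactor F; fullGSizedObjects 3 F.hL b aS ν μ α β c35 p

/-- **(t-U3) THE NODE-U3 PIN (v3)**: node U3's objects of the reading at EVERY Stage-13 tuple with core provisos ARE def-W1's objects of record KEYED TO THE LIMITING (1.21) KERNELS of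
the merged term family of record, `objectsOfRecord₁₃Ax F 2 θ (ℓ F θ)` (W1-19 `Node00/U3OfKernels` p590183), at the letter block read by `ℓ` — the `hpin` hypothesis of dag-n22-w3's
`n22At_rateCarriers_of_kernels_pin[_of_ne9]`, dag-n18-w2's `sensitiveOnBoxes_rateCarriers_of_kernels_pin` and dag-n27-w1's `readOutAt_objectsOfRecord₁₃_coPH` VERBATIM. -/
def U3PinnedKernels (𝔯 : RateReading13AxP) (ℓ : LetterReading) : Prop :=
  ∀ (F : T4Family) (θ : Stage13HParams F 2) (hP : θ.Provisos₁₃CoPHAx F 2) (g₀ : ℕ → ℝ) (os : List (ULoop F)),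
    (𝔯.lit F θ hP g₀ os).u3 = objectsOfRecord₁₃Ax F 2 θ.toStage13Params (ℓ F θ)

/-- **(t-N14) THE N14 PIN (v4)** = dag-n14-w1's `YMDAG.N14.TopBorn.Ne1PinnedOfRecord 𝔯` BY NAME (FILE 3 p593177): the reading's dressed source tower at EVERY Stage-13 tuple with core
provisos IS the object of record `ne1OfRecord l₀ Λ` for SOME `l₀ > 0`, `Λ ≥ 0` — the tower READ OFF THE DATUM's scheme (averaged loop variables at `g₀`, `os`); by FILE 5 p597335
`ne1OfRecord_eq_ne1UnitScale` it is ALSO g0's unit-scale model at `M = 1` (one element of `NE1pCarriers`; «model-level» vs «object» is a label question, n14-w1 l.27241). -/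
theorem ne1PinnedOfRecord_iff (𝔯 : RateReading13AxP) :
    Ne1PinnedOfRecordAx 𝔯 ↔ ∃ l₀ Λ : ℝ, 0 < l₀ ∧ 0 ≤ Λ ∧
      ∀ (F : T4Family) (θ : Stage13HParams F 2) (hP : θ.Provisos₁₃CoPHAx F 2) (g₀ : ℕ → ℝ) (os : List (ULoop F)), 𝔯.ne1 F θ hP g₀ os = ne1OfRecordAx l₀ Λ F θ hP g₀ os :=
  Iff.rfl

/-- **THE PINNED READING WITH ONE GUARD** (v4): the N14 pin `Ne1PinnedOfRecord 𝔯` ((t-N14), replaces v3's guard `Ne1NondegenerateOn`, which it RECOVERS), N15's keyed liveness of the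
paired families at the selected level (the one remaining GUARD — on the reading, not an estimate), the (α-N15) model-level pin `N15PinnedSized 𝔯` and the node-U3 pin `U3PinnedKernels 𝔯 ℓ`;
v3's N18 guard `KeyedSensitive` is DROPPED (№ 13).  All three object families `ne1 ∕ ne2 ∕ u3` of the reading are now pinned BY NAME to constructed objects of record. -/
def GuardedReading (𝔯 : RateReading13AxP) (ksel : RunSel) (ℓ : LetterReading) : Prop :=
  Ne1PinnedOfRecordAx 𝔯 ∧ KeyedLiveAx (rrOfRecord 𝔯 ksel) ∧ N15PinnedSized 𝔯 ∧ U3PinnedKernels 𝔯 ℓ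

/-- **THE RADIUS MATCH ROW** (v5; dag-n16-e ANSWER l.28163 with print's `B₃` generalised to the pinned letter `B`): the loose data radius `(ℓ₃ F).ε ∕ B F` is POSITIVE-keyed
(`0 < B F` — refuses the empty-data junk road `B ≤ 0`) and lies INSIDE the letters' regularity window `≤ (ℓ₃ F).b`, so node N19's link reading takes `ε₁ := (ℓ₃ F).ε ∕ B F ≤ R.ne3.b`
(module 44 `dom_subset_sfClass_of_pinnedLoose`) and `ε₁ ≤ 1∕4` from THE END's `b`-row of `N16LettersEnd`.  A SHAPE; delivered by the N16 producers (module 43 §4 ∕ p602214). -/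
def N16RadiusMatch (ℓ₃ : T4Family → Node00.NE3Letters₁₁) (B : T4Family → ℝ) : Prop :=
  ∀ F : T4Family, 0 < B F ∧ (ℓ₃ F).ε / B F ≤ (ℓ₃ F).b

/-- **THE PINNED READING WITH NODE N16's LAYER PINNED LOOSE** (v5, (t-N16)): v4's `GuardedReading` AND node N16's NE3 layer of the reading IS RR-1's constant layer of record read by
the letters `ℓ₃` with its data CUT at radius `(ℓ₃ F).ε ∕ B F` (`N16PinnedLoose 𝔯 ℓ₃ B`, module 43; print: `B = B₃`), the letters carrying THE END's rows at the coupling letter `g`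
(`N16LettersEnd 2 g ℓ₃`) and the radius MATCH row node N19's link reading consumes (`N16RadiusMatch ℓ₃ B`).  All FOUR object families `ne1 ∕ ne2 ∕ ne3 ∕ u3` of the reading are now pinned BY NAME. -/
def GuardedReadingN16 (𝔯 : RateReading13AxP) (ksel : RunSel) (ℓ : LetterReading) (ℓ₃ : T4Family → Node00.NE3Letters₁₁) (g B : T4Family → ℝ) : Prop :=
  GuardedReading 𝔯 ksel ℓ ∧ N16PinnedLooseAx 𝔯 ℓ₃ B ∧ N16LettersEnd 2 g ℓ₃ ∧ N16RadiusMatch ℓ₃ B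

/-- v5: the N16-pinned reading IS a v4 guarded reading (every v4 lemma below applies through this projection). -/
theorem guardedReading_of_n16 {𝔯 : RateReading13AxP} {ksel : RunSel} {ℓ : LetterReading} {ℓ₃ : T4Family → Node00.NE3Letters₁₁} {g B : T4Family → ℝ}
    (h : GuardedReadingN16 𝔯 ksel ℓ ℓ₃ g B) : GuardedReading 𝔯 ksel ℓ := h.1

/-- v8e: THE REGIME OF RECORD AT THE RE-CENTRED SLOTS — `Node00.unityNondeg₁₃H 2` (`ZhUnity ∧ SlotsNondegenerate₁₃`) with the slots guard read at its Ax twin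
`θ.SlotsNondegenerate₁₃Ax F 2` (the guard every keyed face of this skeleton displays; no `unityNondeg₁₃HAx` abbrev exists in `Node00`, so it is spelled here). -/
abbrev UnityNondegAx : (F : T4Family) → Stage13HParams F 2 → Prop :=
  fun F θ => θ.ZhUnity F 2 ∧ θ.SlotsNondegenerate₁₃Ax F 2

/-- **(t-N14) THE PIN RECOVERS v3's GUARD** (dag-n14-w1 FILE 3 `guard_and_s_N14_of_ne1PinnedOfRecord`; draft fa70673c442bca57): a pinned reading passes dag-n14-w2's keyed guard of
record in the regime of record `Node00.unityNondeg₁₃H 2`. -/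
theorem ne1NondegenerateOn_of_guardedReading {𝔯 : RateReading13AxP} {ksel : RunSel} {ℓ : LetterReading} (h : GuardedReading 𝔯 ksel ℓ) :
    Ne1NondegenerateOnAx 𝔯 UnityNondegAx :=
  ne1NondegenerateOnCmap_of_ne1PinnedOfRecord 𝔯 UnityNondegAx h.1

/-- **(t-N14) UNDER THE PIN THE N14 CONJUNCT AT THE BUNDLE OF RECORD HOLDS OUTRIGHT** (dag-n14-w1 FILE 3 `n14At_rateCarriersOfRecord₁₃CoPH_of_pinned` — the object of record
`ne1OfRecord l₀ Λ` READS the datum; `N14At` on it is the observable budget from `|avgObs| ≤ 1`; N14 NOT discharged by this — dag-lead's rule, chair's acts (i)–(v)). -/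
theorem n14At_rrOfRecord_of_pinned (𝔯 : RateReading13AxP) (ksel : RunSel) (hpin : Ne1PinnedOfRecordAx 𝔯) (F : T4Family) (θ : Stage13HParams F 2)
    (hP : θ.Provisos₁₃CoPHAx F 2) (g₀ : ℕ → ℝ) (os : List (ULoop F)) : N14At (rrOfRecord 𝔯 ksel F θ hP g₀ os).ne1 :=
  n14At_rateCarriersCmap_of_pinned 𝔯 hpin F θ hP g₀ os (ksel F θ hP g₀ os)

/-- N20 · NE7b `RelWeightBound` at the spine reading (leaf D's `h20` shape). -/
def KeyedRelWeight (cr : SpineReading) : Prop :=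
  ∀ (F : T4Family) (θ : Stage13HParams F 2) (hP : θ.Provisos₁₃CoPHAx F 2), (θ.ZhUnity F 2 ∧ θ.SlotsNondegenerate₁₃Ax F 2) → θ.Admissible F 2 →
    ∀ (g₀ : ℕ → ℝ) (os : List (ULoop F)),
      RelWeightBound (cr F θ hP g₀ os).l₀ (cr F θ hP g₀ os).T (cr F θ hP g₀ os).A (cr F θ hP g₀ os).B (cr F θ hP g₀ os).Bad (cr F θ hP g₀ os).W

/-- N21 · NE7c `ShellWeightBound` at the spine reading (leaf D's `h21` shape). -/
def KeyedShellWeight (cr : SpineReading) : Prop :=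
  ∀ (F : T4Family) (θ : Stage13HParams F 2) (hP : θ.Provisos₁₃CoPHAx F 2), (θ.ZhUnity F 2 ∧ θ.SlotsNondegenerate₁₃Ax F 2) → θ.Admissible F 2 →
    ∀ (g₀ : ℕ → ℝ) (os : List (ULoop F)),
      ShellWeightBound (cr F θ hP g₀ os).l₀ (cr F θ hP g₀ os).T (cr F θ hP g₀ os).A (cr F θ hP g₀ os).B (cr F θ hP g₀ os).shA (cr F θ hP g₀ os).shB
        (cr F θ hP g₀ os).Wsh

/-- N19′ (v4, (t9)∕№204) · the NE7 core two-run matching with SOME summable `δ` on the shell-free cores, GIVEN the R-β rates with (D4) at the rate reading, at every guarded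
admissible tuple UNDER THE CRUX's OWN PREFIX `(B) → EndpointExistence → ForSmallCouplings D` — the `h19` shape of dag-n19-w3's `keyedGuarded₁₃CoPH_of_keyedFacesP_fsc` VERBATIM at
`P := PHolderD4 β` (v2∕v3: leaf D's ∀-`g₀` shape; dag-n19-w3's `forSmallCouplings_keyedCoreEdgeHolderD4_of_linkReadingAtRuns` p593217 supplies exactly this shape GIVEN K1⁷'s
interval-form β-window at the tuple). -/
def KeyedCoreEdgeHolderD4 (β : ℝ) (cr : SpineReading) (rr : RateReadingFn) : Prop :=
  ∀ (F : T4Family) (θ : Stage13HParams F 2) (hP : θ.Provisos₁₃CoPHAx F 2), (θ.ZhUnity F 2 ∧ θ.SlotsNondegenerate₁₃Ax F 2) → θ.Admissible F 2 →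
    B16.EndStatementBPrinted (datumOfRecord₁₃CoPHAx F 2 θ hP).C → DagBinding.EndpointExistence (datumOfRecord₁₃CoPHAx F 2 θ hP).C.toB12 →
      ForSmallCouplings (datumOfRecord₁₃CoPHAx F 2 θ hP) fun g₀ => ∀ os : List (ULoop F),
        PHolderD4 β (datumOfRecord₁₃CoPHAx F 2 θ hP) (rr F θ hP g₀ os) → letI := (cr F θ hP g₀ os).dec
          ∃ δ : ℕ → ℝ, NE7.Core (cr F θ hP g₀ os).l₀ (cr F θ hP g₀ os).vol (cr F θ hP g₀ os).T (cr F θ hP g₀ os).Bad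
            (fun K t τ => (cr F θ hP g₀ os).A K t τ - (cr F θ hP g₀ os).shA K t τ) (fun K t τ => (cr F θ hP g₀ os).B K t τ - (cr F θ hP g₀ os).shB K t τ) δ ∧
            Summable δ

/-- N27x · extraction at the spine reading (leaf D's `hx` shape). -/
def KeyedExtraction (cr : SpineReading) : Prop :=
  ∀ (F : T4Family) (θ : Stage13HParams F 2) (hP : θ.Provisos₁₃CoPHAx F 2), (θ.ZhUnity F 2 ∧ θ.SlotsNondegenerate₁₃Ax F 2) → θ.Admissible F 2 →
    B16.EndStatementBPrinted (datumOfRecord₁₃CoPHAx F 2 θ hP).C → DagBinding.EndpointExistence (datumOfRecord₁₃CoPHAx F 2 θ hP).C.toB12 →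
      ForSmallCouplings (datumOfRecord₁₃CoPHAx F 2 θ hP) fun g₀ => ∀ os : List (ULoop F),
        0 < (cr F θ hP g₀ os).l₀ ∧ 0 < (cr F θ hP g₀ os).vol ∧
        (∀ (K : ℕ) (t : ℝ), |t| ≤ (cr F θ hP g₀ os).l₀ →
          T4GenFunBounds.schemeZ ((datumOfRecord₁₃CoPHAx F 2 θ hP).scheme g₀) os ((cr F θ hP g₀ os).K₀ + K) t =
            ∑ τ ∈ (cr F θ hP g₀ os).T K, (cr F θ hP g₀ os).A K t τ) ∧
        (∀ (K : ℕ) (t : ℝ), |t| ≤ (cr F θ hP g₀ os).l₀ →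
          T4GenFunBounds.schemeZ ((datumOfRecord₁₃CoPHAx F 2 θ hP).scheme g₀) os ((cr F θ hP g₀ os).K₀ + K + 1) t =
            ∑ τ ∈ (cr F θ hP g₀ os).T K, (cr F θ hP g₀ os).B K t τ)

/-! ## §1V (v6, plan g85, rev 28 recipe (δⱽ)) THE THREE (B)-PREFIXED FACES RE-KEYED AT THE VERSION SLOT + their (B)-FREE shapes and transfer lemmas —
VERBATIM from dag-n17-w2 g6's probe `Cruxes/SpineGivenEndpointR13SepCoPH/N17W2K3R8VersionSlotProbe.lean` (crux write e844e77117ee, sha16 5383fcf40d3897f5, farm rc 0): the face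
texts OF RECORD for K3⁸ — key = the item's own separated provisos `h` + DEF-1's slot `v : Node00.Revision₁₃Ax F 2 θ h`; prefix ∕ holder ∕ partition functions read at the re-chosen
datum `Node00.datumOfRecord₁₃SepCoPHVAx F 2 θ h v`; readings `cr`∕`rr` at `h.toCore`.  (Its §1 `Iff.rfl` slot faces and the §3 `hBdown` display stay in that file.) -/

open Node00 (datumOfRecord₁₃SepCoPHAx datumOfRecord₁₃SepCoPHVAx Revision₁₃Ax)

/-- CANDIDATE «K4 at the slot»: v5's `KeyedRatesHolderD4 β rr` under one extra binder `v`, with (B), END, `ForSmallCouplings`, `PHolderD4` read at `datumOfRecord₁₃SepCoPHVAx F 2 θ h v`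
(the reading `rr` stays keyed on the CORE provisos, `h.toCore`). -/
def KeyedRatesHolderD4V (β : ℝ) (rr : RateReadingFn) : Prop :=
  ∀ (F : T4Family) (θ : Stage13HParams F 2) (h : θ.Provisos₁₃SepCoPHAx F 2) (v : Revision₁₃Ax F 2 θ h), (θ.ZhUnity F 2 ∧ θ.SlotsNondegenerate₁₃Ax F 2) → θ.Admissible F 2 →
    B16.EndStatementBPrinted (datumOfRecord₁₃SepCoPHVAx F 2 θ h v).C → DagBinding.EndpointExistence (datumOfRecord₁₃SepCoPHVAx F 2 θ h v).C.toB12 →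
      ForSmallCouplings (datumOfRecord₁₃SepCoPHVAx F 2 θ h v) fun g₀ => ∀ os : List (ULoop F), PHolderD4 β (datumOfRecord₁₃SepCoPHVAx F 2 θ h v) (rr F θ h.toCore g₀ os)

/-- the (B)-FREE, END-FREE shape of the K4 face — what every ∀-`g₀` supplier road (`ForSmallCouplings.of_forall`) and every road not reading (B) actually proves. -/
def KeyedRatesHolderD4BFree (β : ℝ) (rr : RateReadingFn) : Prop :=
  ∀ (F : T4Family) (θ : Stage13HParams F 2) (hP : θ.Provisos₁₃CoPHAx F 2), (θ.ZhUnity F 2 ∧ θ.SlotsNondegenerate₁₃Ax F 2) → θ.Admissible F 2 →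
    ForSmallCouplings (datumOfRecord₁₃CoPHAx F 2 θ hP) fun g₀ => ∀ os : List (ULoop F), PHolderD4 β (datumOfRecord₁₃CoPHAx F 2 θ hP) (rr F θ hP g₀ os)

/-- **(3) a (B)-free road of v5's K4 face TRANSFERS TO EVERY VERSION `v` VERBATIM** (the two `Iff.rfl` faces of §1). -/
theorem keyedRatesHolderD4V_of_bFree {β : ℝ} {rr : RateReadingFn} (hfree : KeyedRatesHolderD4BFree β rr) : KeyedRatesHolderD4V β rr :=
  fun F θ h _v hG hθ _ _ => hfree F θ h.toCore hG hθ

/-- … and of course gives v5's own (B)-keyed face. -/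
theorem keyedRatesHolderD4_of_bFree {β : ℝ} {rr : RateReadingFn} (hfree : KeyedRatesHolderD4BFree β rr) : KeyedRatesHolderD4 β rr :=
  fun F θ hP hG hθ _ _ => hfree F θ hP hG hθ

/-- DOOR (`v := Revision₁₃Ax.refl`): the slot-keyed K4 face at every `v` gives v5's face on the SEPARATED-provisos tuples (the item's own key; `datumOfRecord₁₃SepCoPHVAx … (.refl) =
datumOfRecord₁₃SepCoPHAx …` by `rfl`). -/
theorem keyedRatesHolderD4Sep_of_V {β : ℝ} {rr : RateReadingFn} (hV : KeyedRatesHolderD4V β rr) (F : T4Family) (θ : Stage13HParams F 2) (h : θ.Provisos₁₃SepCoPHAx F 2)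
    (hG : θ.ZhUnity F 2 ∧ θ.SlotsNondegenerate₁₃Ax F 2) (hθ : θ.Admissible F 2) (hB : B16.EndStatementBPrinted (datumOfRecord₁₃SepCoPHAx F 2 θ h).C)
    (hE : DagBinding.EndpointExistence (datumOfRecord₁₃SepCoPHAx F 2 θ h).C.toB12) :
    ForSmallCouplings (datumOfRecord₁₃CoPHAx F 2 θ h.toCore) fun g₀ => ∀ os : List (ULoop F), PHolderD4 β (datumOfRecord₁₃CoPHAx F 2 θ h.toCore) (rr F θ h.toCore g₀ os) :=
  hV F θ h (Revision₁₃Ax.refl F 2 θ h) hG hθ hB hE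

/-- CANDIDATE «N19′ at the slot»: v5's `KeyedCoreEdgeHolderD4 β cr rr` under the binder `v`, prefix and `PHolderD4` read at the revised datum (the spine reading `cr` and the rate reading
`rr` stay keyed on the core provisos). -/
def KeyedCoreEdgeHolderD4V (β : ℝ) (cr : SpineReading) (rr : RateReadingFn) : Prop :=
  ∀ (F : T4Family) (θ : Stage13HParams F 2) (h : θ.Provisos₁₃SepCoPHAx F 2) (v : Revision₁₃Ax F 2 θ h), (θ.ZhUnity F 2 ∧ θ.SlotsNondegenerate₁₃Ax F 2) → θ.Admissible F 2 →
    B16.EndStatementBPrinted (datumOfRecord₁₃SepCoPHVAx F 2 θ h v).C → DagBinding.EndpointExistence (datumOfRecord₁₃SepCoPHVAx F 2 θ h v).C.toB12 →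
      ForSmallCouplings (datumOfRecord₁₃SepCoPHVAx F 2 θ h v) fun g₀ => ∀ os : List (ULoop F),
        PHolderD4 β (datumOfRecord₁₃SepCoPHVAx F 2 θ h v) (rr F θ h.toCore g₀ os) → letI := (cr F θ h.toCore g₀ os).dec
          ∃ δ : ℕ → ℝ, NE7.Core (cr F θ h.toCore g₀ os).l₀ (cr F θ h.toCore g₀ os).vol (cr F θ h.toCore g₀ os).T (cr F θ h.toCore g₀ os).Bad
            (fun K t τ => (cr F θ h.toCore g₀ os).A K t τ - (cr F θ h.toCore g₀ os).shA K t τ)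
            (fun K t τ => (cr F θ h.toCore g₀ os).B K t τ - (cr F θ h.toCore g₀ os).shB K t τ) δ ∧ Summable δ

/-- the (B)-FREE, END-FREE shape of the N19′ face (every road not reading (B) ∕ END proves this). -/
def KeyedCoreEdgeHolderD4BFree (β : ℝ) (cr : SpineReading) (rr : RateReadingFn) : Prop :=
  ∀ (F : T4Family) (θ : Stage13HParams F 2) (hP : θ.Provisos₁₃CoPHAx F 2), (θ.ZhUnity F 2 ∧ θ.SlotsNondegenerate₁₃Ax F 2) → θ.Admissible F 2 →
    ForSmallCouplings (datumOfRecord₁₃CoPHAx F 2 θ hP) fun g₀ => ∀ os : List (ULoop F),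
      PHolderD4 β (datumOfRecord₁₃CoPHAx F 2 θ hP) (rr F θ hP g₀ os) → letI := (cr F θ hP g₀ os).dec
        ∃ δ : ℕ → ℝ, NE7.Core (cr F θ hP g₀ os).l₀ (cr F θ hP g₀ os).vol (cr F θ hP g₀ os).T (cr F θ hP g₀ os).Bad
          (fun K t τ => (cr F θ hP g₀ os).A K t τ - (cr F θ hP g₀ os).shA K t τ) (fun K t τ => (cr F θ hP g₀ os).B K t τ - (cr F θ hP g₀ os).shB K t τ) δ ∧ Summable δ

/-- **(3) a (B)-free road of v5's N19′ face TRANSFERS TO EVERY VERSION `v` VERBATIM.** -/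
theorem keyedCoreEdgeHolderD4V_of_bFree {β : ℝ} {cr : SpineReading} {rr : RateReadingFn} (hfree : KeyedCoreEdgeHolderD4BFree β cr rr) :
    KeyedCoreEdgeHolderD4V β cr rr :=
  fun F θ h _v hG hθ _ _ => hfree F θ h.toCore hG hθ

/-- … and gives v5's own face. -/
theorem keyedCoreEdgeHolderD4_of_bFree {β : ℝ} {cr : SpineReading} {rr : RateReadingFn} (hfree : KeyedCoreEdgeHolderD4BFree β cr rr) :
    KeyedCoreEdgeHolderD4 β cr rr :=
  fun F θ hP hG hθ _ _ => hfree F θ hP hG hθ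

/-- CANDIDATE «N27x at the slot»: v5's `KeyedExtraction cr` under the binder `v`, prefix and partition functions read at the revised datum. -/
def KeyedExtractionV (cr : SpineReading) : Prop :=
  ∀ (F : T4Family) (θ : Stage13HParams F 2) (h : θ.Provisos₁₃SepCoPHAx F 2) (v : Revision₁₃Ax F 2 θ h), (θ.ZhUnity F 2 ∧ θ.SlotsNondegenerate₁₃Ax F 2) → θ.Admissible F 2 →
    B16.EndStatementBPrinted (datumOfRecord₁₃SepCoPHVAx F 2 θ h v).C → DagBinding.EndpointExistence (datumOfRecord₁₃SepCoPHVAx F 2 θ h v).C.toB12 →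
      ForSmallCouplings (datumOfRecord₁₃SepCoPHVAx F 2 θ h v) fun g₀ => ∀ os : List (ULoop F),
        0 < (cr F θ h.toCore g₀ os).l₀ ∧ 0 < (cr F θ h.toCore g₀ os).vol ∧
        (∀ (K : ℕ) (t : ℝ), |t| ≤ (cr F θ h.toCore g₀ os).l₀ →
          T4GenFunBounds.schemeZ ((datumOfRecord₁₃SepCoPHVAx F 2 θ h v).scheme g₀) os ((cr F θ h.toCore g₀ os).K₀ + K) t =
            ∑ τ ∈ (cr F θ h.toCore g₀ os).T K, (cr F θ h.toCore g₀ os).A K t τ) ∧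
        (∀ (K : ℕ) (t : ℝ), |t| ≤ (cr F θ h.toCore g₀ os).l₀ →
          T4GenFunBounds.schemeZ ((datumOfRecord₁₃SepCoPHVAx F 2 θ h v).scheme g₀) os ((cr F θ h.toCore g₀ os).K₀ + K + 1) t =
            ∑ τ ∈ (cr F θ h.toCore g₀ os).T K, (cr F θ h.toCore g₀ os).B K t τ)

/-- the (B)-FREE, END-FREE shape of the N27x face. -/
def KeyedExtractionBFree (cr : SpineReading) : Prop :=
  ∀ (F : T4Family) (θ : Stage13HParams F 2) (hP : θ.Provisos₁₃CoPHAx F 2), (θ.ZhUnity F 2 ∧ θ.SlotsNondegenerate₁₃Ax F 2) → θ.Admissible F 2 →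
    ForSmallCouplings (datumOfRecord₁₃CoPHAx F 2 θ hP) fun g₀ => ∀ os : List (ULoop F),
      0 < (cr F θ hP g₀ os).l₀ ∧ 0 < (cr F θ hP g₀ os).vol ∧
      (∀ (K : ℕ) (t : ℝ), |t| ≤ (cr F θ hP g₀ os).l₀ →
        T4GenFunBounds.schemeZ ((datumOfRecord₁₃CoPHAx F 2 θ hP).scheme g₀) os ((cr F θ hP g₀ os).K₀ + K) t = ∑ τ ∈ (cr F θ hP g₀ os).T K, (cr F θ hP g₀ os).A K t τ) ∧
      (∀ (K : ℕ) (t : ℝ), |t| ≤ (cr F θ hP g₀ os).l₀ →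
        T4GenFunBounds.schemeZ ((datumOfRecord₁₃CoPHAx F 2 θ hP).scheme g₀) os ((cr F θ hP g₀ os).K₀ + K + 1) t = ∑ τ ∈ (cr F θ hP g₀ os).T K, (cr F θ hP g₀ os).B K t τ)

/-- **(3) a (B)-free road of v5's N27x face TRANSFERS TO EVERY VERSION `v` VERBATIM** (the partition functions are the record's, `schemeZ_slot`). -/
theorem keyedExtractionV_of_bFree {cr : SpineReading} (hfree : KeyedExtractionBFree cr) : KeyedExtractionV cr :=
  fun F θ h _v hG hθ _ _ => hfree F θ h.toCore hG hθ

/-- … and gives v5's own face. -/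
theorem keyedExtraction_of_bFree {cr : SpineReading} (hfree : KeyedExtractionBFree cr) : KeyedExtraction cr :=
  fun F θ hP hG hθ _ _ => hfree F θ hP hG hθ

/-! ## §1c (A3-i) THE SPINE READING OF RECORD, PINNED ON THE LIVE-SELECTOR LINE -/

/-- **THE LIVE-SELECTOR LINE** (N24 ∕ K1-side currency): the tuple's residual present-slot selector IS the live selector of record read at the record's `E` and step weights —
the hypothesis `hsel` under which dag-n20-d's `keyedExtraction_crOfRecord₁₃At` makes N27x a THEOREM at `crOfRecord₁₃`. -/
def LiveSel (F : T4Family) (θ : Stage13HParams F 2) : Prop :=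
  θ.ppSel = Node00.ppSelLiveOfRecord F 2 θ.ν θ.τ9 (Node00.EOfRecord₁₃Ax F 2 θ.toStage13Params) (Node00.wOfRecord₉ F 2 θ.toStage9Params)

/-- **PINNED AT LIVE** (v3): on the live-selector line the spine reading IS dag-n20-d's spine reading of record WITH THE PHYSICAL VOLUME LETTER `crOfRecord₁₃V (jc F θ hP g₀ os) sh`
read AT THE TUPLE (index = the (K₀+K+1)-histories classed by their K₀-prefix, NE8 weights `weightA₁₃ ∕ weightB₁₃`, canonical least `W` ∕ `Wsh`, `δ` displayed as `deltaCan` at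
`vol = F.side ^ 4`, large-field cut depth `jc F θ hP g₀ os : ℕ → ℕ` READ PER TUPLE ((t-JC)), shell split `sh` read per tuple); off that line the reading is free. -/
def PinnedAtLive (jc : CutReading) (sh : ShellSplit₁₃CoPHAx 2 0) (cr : SpineReading) : Prop :=
  ∀ (F : T4Family) (θ : Stage13HParams F 2) (hP : θ.Provisos₁₃CoPHAx F 2) (g₀ : ℕ → ℝ) (os : List (ULoop F)),
    LiveSel F θ → cr F θ hP g₀ os = crOfRecord₁₃VAx (jc F θ hP g₀ os) sh F θ hP g₀ os

/-- **PINNED AT LIVE, GAPPED (pair form) — v7** (probe evidence #46 §1 VERBATIM): v6's `PinnedAtLive jc sh cr` with the reading of record `crOfRecord₁₃V (jc …) sh`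
replaced by dag-n21-w7's DOUBLY-GAPPED reading `crGap2₁₃V 2 (jc …) ρ ρ′ n₁ n₂` — the top step's (3.2) indicator family gapped at the selected letter of the grid `ε(1−ρ)^i`
(depth `n₁`) AND its (3.3) family at the grid of `ρ′` (depth `n₂`); index, class set, bad class `badClass₁₃ θ 0 g₀ (jc …)`, `l₀ = 1`, `vol = F.side⁴`, canonical `W ∕ Wsh ∕ δ`
exactly as `crOfRecord₁₃V` ([Balaban1989LargeFieldI] p. 181 «we change the regularity conditions by a factor»).  Width letters `ρ ρ′ : WidthLetter₁₃CoPH 2` and depth letters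
`n₁ n₂ : DepthLetter₁₃CoPH 2` are READ PER TUPLE like `jc`; off the live line the reading is free (v2's located reason, unchanged). -/
def PinnedAtLiveGap2 (jc : CutReading) (ρ ρ' : WidthLetter₁₃CoPHAx 2) (n₁ n₂ : DepthLetter₁₃CoPHAx 2) (cr : SpineReading) : Prop :=
  ∀ (F : T4Family) (θ : Stage13HParams F 2) (hP : θ.Provisos₁₃CoPHAx F 2) (g₀ : ℕ → ℝ) (os : List (ULoop F)),
    LiveSel F θ → cr F θ hP g₀ os = crGap2₁₃VAx (jc F θ hP g₀ os) ρ ρ' n₁ n₂ F θ hP g₀ os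

/-- **THE DIAL ROWS — v7** (probe §1 VERBATIM): widths in `[0, 1]`, depths with `Σ_K (1∕(n₁ K + 1) + 1∕(n₂ K + 1)) < ∞`, at every tuple — the two rows every gapped
face file displays (dag-n21-w7 `shellWeightBound_crGap2₁₃VAt_signFree`, dag-n21-d V3∕V8, dag-n21-w2 `…KnitOfCloseness`, which PRODUCES the dials from one closeness letter per
indicator family, `exists_gap2Pinned_faces_of_closeness` p645435).  Conjoined to the pin so that the dials are the PROVER's and their rows VISIBLE. -/
def DialRows (ρ ρ' : WidthLetter₁₃CoPHAx 2) (n₁ n₂ : DepthLetter₁₃CoPHAx 2) : Prop :=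
  (∀ (F : T4Family) (θ : Stage13HParams F 2) (hP : θ.Provisos₁₃CoPHAx F 2) (g₀ : ℕ → ℝ) (os : List (ULoop F)) (K : ℕ),
      (0 ≤ ρ F θ hP g₀ os K ∧ ρ F θ hP g₀ os K ≤ 1) ∧ (0 ≤ ρ' F θ hP g₀ os K ∧ ρ' F θ hP g₀ os K ≤ 1)) ∧
  (∀ (F : T4Family) (θ : Stage13HParams F 2) (hP : θ.Provisos₁₃CoPHAx F 2) (g₀ : ℕ → ℝ) (os : List (ULoop F)),
      Summable (fun K => 1 / ((n₁ F θ hP g₀ os K : ℝ) + 1) + 1 / ((n₂ F θ hP g₀ os K : ℝ) + 1)))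

end Summit.QuantumFields.YangMills.Theorems.K3AxV8Defs

end
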